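import Mathlib
import Summits.ValiantsHypothesis.ValiantsHypothesis.Theorems.KPlusLogSqLawTropicalCensusRows

/-!
# A STATIC, DEFINITE-DIAGONAL symmetric tridiagonal `6 × 6` monomial pencil with SIX distinct positive determinant zeros

HONEST FRAMING.  Helper datum (seat val-sym-lift-p2 g8, cell `pub-symmetroid`, 2026-08-27) for the desk's TYPED α TARGET of record
(lead R2102, val-sym-lift-p3 g8): «`staticTridiagonal_definite_posRoots_le` — a real symmetric TRIDIAGONAL matrix of MONOMIALS
`c i j · X ^ (e i j)` (one monomial per entry = a STATIC design) with POSITIVE DIAGONAL COEFFICIENTS (`0 < c i i`, the definite-diagonal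
sub-sector) has at most `B m` distinct positive determinant zeros», filed with the CONJECTURED SHARP constant `B m = m − 1`.  This file
REFUTES that constant at `m = 6`: there is such a matrix with (at least) `6 = m` distinct positive determinant zeros
(`exists_staticTridiagonal_definite_six`, `not_staticTridiagonal_definite_posRoots_le_pred`).  It says NOTHING about a linear law
`B m ≤ C·m` (which remains the α row), about `stub_tridiagonalSectorB` / `WeakLifting` (stmt-ValiantsHypothesis-19561) in their window,
`TropicalB`, Conjecture B, the Door-A registers, `MatrixDescartes` (stmt-ValiantsHypothesis-18050) or VP ≠ VNP.  It is a FIXED-FORMAT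
statement (calibration / target-repair; zero W-credit).

WHAT IS PROVED, AND HOW.  After the conjugation `x ↦ diag(x^{-κ_i})` that removes the off-diagonal exponents, the determinant of a static
definite tridiagonal pencil is a positive monomial times `p_m(x) = Σ_{M matching of the path} (−1)^{|M|} ∏_{t ∈ M} W_t(x)` with one positive
monomial `W_t` per path edge, so the sign of the dominant term is the PARITY of the optimal matching.  The tropical twin is the parametric
maximum-weight matching of the path `P₆` with item lines `W_t(θ) = a_t θ + c_t`; a hub-light search found item lines
`(a_t) = (−4, −8, −2, 12, 22)`, `(c_t) = (−30, −22, 126, 170, −46)` whose chain of unique optima is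
`{2} → {1,3} → {3} → {2,4} → {4} → {3,5} → {5}` (at the integer slopes `θ = −81, −25, −5, −3, 5, 22, 122`): the matching SIZE alternates
`1,2,1,2,1,2,1`, i.e. SIX sign alternations with `m = 6` vertices — one more than the «one event per item» count `m − 1`.  The design is
typed in the tree's vocabulary (`IsDominant` / `termSign` of `MatrixDescartesFalseOfTropicalMonster`): format `(6, 6)`, exponents
`D = (0, 2, 3, 4, 10, 15)`, every entry carries exactly ONE class (diagonal: exponent `4`, valuation `0`, sign `+1`; edge `t`: exponent
`4 + a_t/2`, valuation `v'_t = −c_t/2 = (15, 11, −63, −85, 23)`, sign `+1`), corner/off-band entries ABSENT; dominance of the seven chain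
terms is certified by `decide` through the tree's dual certificate `isDominant_of_scaledPotential` (scale `S = 2`, potentials `U, W` found
by Bellman–Ford on the assignment dual, margins ≥ 2), sign alternation by `decide` on `termSign` (including `Equiv.Perm.sign`).  Viro
patchworking at base `b = 6!·6⁶ + 1 = 33 592 321` (the tree's `det_patch_alternates` + `SymmetroidDescartes.le_card_posRoots_of_alternating`)
turns it into the real pencil `X⁴·I₆ + N(X)`, `N` symmetric tridiagonal with the five off-diagonal monomials `b^{−v'_t} X^{4 + a_t/2}`,
whose determinant has `≥ 6` distinct positive zeros; its diagonal coefficients are `1 > 0`.  Located context (this seat, not claimed in the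
kernel): parity-alternating chains of length `m` were also found at `m = 7, 8`; with an INDEFINITE diagonal the signed chains of the cell's
`2n − 4` event-maximizers (val-sym-lift-p4 g7) reach `7, 8, 10, 12, 13, 14, 16, 17` alternations at `m = 7 … 14`.
[folklore] LP duality / Viro patchworking; data of this seat.
-/

set_option linter.dupNamespace false
set_option autoImplicit false

namespace Summit.ValiantsHypothesis.ValiantsHypothesis.Theorems.KPlusLogSqLaw.TridiagonalSector

open Summit.ValiantsHypothesis.ValiantsHypothesis.Theorems.MatrixDescartes.Negative
open Summit.ValiantsHypothesis.ValiantsHypothesis.Theorems.LacunarySymmetroidMatrixDescartes.TropicalCensus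
open Polynomial Finset

/-- **A STATIC DEFINITE-DIAGONAL symmetric tridiagonal `6 × 6` monomial matrix with `≥ 6` distinct positive determinant zeros**, in the
currency of the typed α target (lead R2102): coefficients `c` and exponents `e` symmetric, `c` vanishing off the band `|i − j| ≤ 1`, every
diagonal coefficient positive.  The witness is `X⁴·I₆ + N(X)` with `N₀₁ = b⁻¹⁵X², N₁₂ = b⁻¹¹, N₂₃ = b⁶³X³, N₃₄ = b⁸⁵X¹⁰, N₄₅ = b⁻²³X¹⁵`
(symmetric), `b = 33 592 321` (Viro patchworking of the design described in the module docstring). [folklore patchworking; data of this seat] -/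
theorem exists_staticTridiagonal_definite_six :
    ∃ (c : Fin 6 → Fin 6 → ℝ) (e : Fin 6 → Fin 6 → ℕ), (∀ i j, c i j = c j i) ∧ (∀ i j, e i j = e j i) ∧
      (∀ i j : Fin 6, (i : ℕ) + 1 < j ∨ (j : ℕ) + 1 < i → c i j = 0) ∧ (∀ i, 0 < c i i) ∧
      6 ≤ ((Matrix.det (Matrix.of fun i j => C (c i j) * (X : ℝ[X]) ^ e i j)).roots.toFinset.filter
        (fun t : ℝ => 0 < t)).card := by
  -- the design (format (6,6)): exponents, valuations, signs; `L i j` = the unique class carried by entry `(i, j)`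
  let D : Fin 6 → ℕ := ![0, 2, 3, 4, 10, 15]
  let L : Fin 6 → Fin 6 → Fin 6 :=
    ![![3, 1, 3, 3, 3, 3], ![1, 3, 0, 3, 3, 3], ![3, 0, 3, 2, 3, 3], ![3, 3, 2, 3, 4, 3], ![3, 3, 3, 4, 3, 5], ![3, 3, 3, 3, 5, 3]]
  let V : Fin 6 → Fin 6 → Fin 6 → ℤ :=
    ![![![0, 0, 0, 0, 0, 0], ![0, 15, 0, 0, 0, 0], ![0, 0, 0, 0, 0, 0], ![0, 0, 0, 0, 0, 0], ![0, 0, 0, 0, 0, 0], ![0, 0, 0, 0, 0, 0]],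
      ![![0, 15, 0, 0, 0, 0], ![0, 0, 0, 0, 0, 0], ![11, 0, 0, 0, 0, 0], ![0, 0, 0, 0, 0, 0], ![0, 0, 0, 0, 0, 0], ![0, 0, 0, 0, 0, 0]],
      ![![0, 0, 0, 0, 0, 0], ![11, 0, 0, 0, 0, 0], ![0, 0, 0, 0, 0, 0], ![0, 0, (-63 : ℤ), 0, 0, 0], ![0, 0, 0, 0, 0, 0],
        ![0, 0, 0, 0, 0, 0]],
      ![![0, 0, 0, 0, 0, 0], ![0, 0, 0, 0, 0, 0], ![0, 0, (-63 : ℤ), 0, 0, 0], ![0, 0, 0, 0, 0, 0], ![0, 0, 0, 0, (-85 : ℤ), 0],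
        ![0, 0, 0, 0, 0, 0]],
      ![![0, 0, 0, 0, 0, 0], ![0, 0, 0, 0, 0, 0], ![0, 0, 0, 0, 0, 0], ![0, 0, 0, 0, (-85 : ℤ), 0], ![0, 0, 0, 0, 0, 0],
        ![0, 0, 0, 0, 0, 23]],
      ![![0, 0, 0, 0, 0, 0], ![0, 0, 0, 0, 0, 0], ![0, 0, 0, 0, 0, 0], ![0, 0, 0, 0, 0, 0], ![0, 0, 0, 0, 0, 23], ![0, 0, 0, 0, 0, 0]]]
  let E : Fin 6 → Fin 6 → Fin 6 → ℤ :=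
    ![![![0, 0, 0, 1, 0, 0], ![0, 1, 0, 0, 0, 0], ![0, 0, 0, 0, 0, 0], ![0, 0, 0, 0, 0, 0], ![0, 0, 0, 0, 0, 0], ![0, 0, 0, 0, 0, 0]],
      ![![0, 1, 0, 0, 0, 0], ![0, 0, 0, 1, 0, 0], ![1, 0, 0, 0, 0, 0], ![0, 0, 0, 0, 0, 0], ![0, 0, 0, 0, 0, 0], ![0, 0, 0, 0, 0, 0]],
      ![![0, 0, 0, 0, 0, 0], ![1, 0, 0, 0, 0, 0], ![0, 0, 0, 1, 0, 0], ![0, 0, 1, 0, 0, 0], ![0, 0, 0, 0, 0, 0], ![0, 0, 0, 0, 0, 0]],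
      ![![0, 0, 0, 0, 0, 0], ![0, 0, 0, 0, 0, 0], ![0, 0, 1, 0, 0, 0], ![0, 0, 0, 1, 0, 0], ![0, 0, 0, 0, 1, 0], ![0, 0, 0, 0, 0, 0]],
      ![![0, 0, 0, 0, 0, 0], ![0, 0, 0, 0, 0, 0], ![0, 0, 0, 0, 0, 0], ![0, 0, 0, 0, 1, 0], ![0, 0, 0, 1, 0, 0], ![0, 0, 0, 0, 0, 1]],
      ![![0, 0, 0, 0, 0, 0], ![0, 0, 0, 0, 0, 0], ![0, 0, 0, 0, 0, 0], ![0, 0, 0, 0, 0, 0], ![0, 0, 0, 0, 0, 1], ![0, 0, 0, 1, 0, 0]]]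
  -- the chain: integer slopes, permutations (matchings {2}, {1,3}, {3}, {2,4}, {4}, {3,5}, {5}), class maps, dual potentials (scale 2)
  let Th : Fin 7 → ℤ := ![(-81 : ℤ), (-25 : ℤ), (-5 : ℤ), (-3 : ℤ), 5, 22, 122]
  let Sg : Fin 7 → Equiv.Perm (Fin 6) :=
    ![(Equiv.swap (1 : Fin 6) 2 : Equiv.Perm (Fin 6)),
      (Equiv.swap (0 : Fin 6) 1 : Equiv.Perm (Fin 6)) * Equiv.swap (2 : Fin 6) 3,
      (Equiv.swap (2 : Fin 6) 3 : Equiv.Perm (Fin 6)),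
      (Equiv.swap (1 : Fin 6) 2 : Equiv.Perm (Fin 6)) * Equiv.swap (3 : Fin 6) 4,
      (Equiv.swap (3 : Fin 6) 4 : Equiv.Perm (Fin 6)),
      (Equiv.swap (2 : Fin 6) 3 : Equiv.Perm (Fin 6)) * Equiv.swap (4 : Fin 6) 5,
      (Equiv.swap (4 : Fin 6) 5 : Equiv.Perm (Fin 6))]
  let Cl : Fin 7 → Fin 6 → Fin 6 :=
    ![![(3 : Fin 6), 0, 0, 3, 3, 3], ![(1 : Fin 6), 1, 2, 2, 3, 3], ![(3 : Fin 6), 3, 2, 2, 3, 3], ![(3 : Fin 6), 0, 0, 4, 4, 3],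
      ![(3 : Fin 6), 3, 3, 4, 4, 3], ![(3 : Fin 6), 3, 2, 2, 5, 5], ![(3 : Fin 6), 3, 3, 3, 5, 5]]
  let U : Fin 7 → Fin 6 → ℤ :=
    ![![(-648 : ℤ), (-332 : ℤ), (-338 : ℤ), (-648 : ℤ), (-648 : ℤ), (-648 : ℤ)],
      ![(-166 : ℤ), (-130 : ℤ), (-24 : ℤ), (-166 : ℤ), (-200 : ℤ), (-200 : ℤ)],
      ![(-40 : ℤ), (-40 : ℤ), (-18 : ℤ), 74, (-40 : ℤ), (-40 : ℤ)],
      ![(-24 : ℤ), (-22 : ℤ), (-22 : ℤ), 110, (-22 : ℤ), (-24 : ℤ)],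
      ![40, 40, 40, 181, 129, 40],
      ![176, 176, 219, 258, 614, 219],
      ![976, 976, 976, 976, 3614, 1862]]
  let W : Fin 7 → Fin 6 → ℤ :=
    ![![0, 316, 310, 0, 0, 0], ![0, 36, 142, 0, 0, 0], ![0, 0, 22, 114, 0, 0], ![0, 0, 0, 132, 0, 0], ![0, 0, 0, 141, 89, 0],
      ![0, 0, 0, 39, 395, 0], ![0, 0, 0, 0, 1752, 0]]
  have hε : ∀ i j l, (E i j l).natAbs ≤ 1 := by decide
  have hθ : StrictMono Th := by rw [Fin.strictMono_iff_lt_succ]; decide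
  have hp : ∀ k i, E (Sg k i) i (Cl k i) ≠ 0 := by decide
  have ht : ∀ k i, U k (Sg k i) + W k i = 2 * (Th k * (D (Cl k i) : ℤ) - V (Sg k i) i (Cl k i)) := by decide
  have hs : ∀ k a b l, E a b l ≠ 0 → (Sg k b ≠ a ∨ Cl k b ≠ l) → 2 * (Th k * (D l : ℤ) - V a b l) < U k a + W k b := by decide
  have hdom : ∀ k, IsDominant D V E (Th k) (Sg k, Cl k) := fun k =>
    isDominant_of_scaledPotential D V E (Th k) (Sg k) (Cl k) 2 (by norm_num) (U k) (W k) (hp k) (ht k) (hs k)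
  have halt : ∀ k : Fin 6, termSign E ((fun k => (Sg k, Cl k)) k.castSucc) * termSign E ((fun k => (Sg k, Cl k)) k.succ) < 0 := by
    decide
  have hVs : ∀ i j l, V i j l = V j i l := by decide
  have hEs : ∀ i j l, E i j l = E j i l := by decide
  have hEc : ∀ l (i j : Fin 6), (i : ℕ) + 1 < j ∨ (j : ℕ) + 1 < i → E i j l = 0 := by decide
  have hL : ∀ i j l, l ≠ L i j → E i j l = 0 := by decide
  have hLs : ∀ i j, L i j = L j i := by decide
  have hLd : ∀ i, E i i (L i i) = 1 ∧ V i i (L i i) = 0 := by decide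
  set b : ℝ := 33592321 with hbdef
  have hcard : (Fintype.card (Equiv.Perm (Fin 6) × (Fin 6 → Fin 6)) : ℝ) < b := by
    rw [Fintype.card_prod, Fintype.card_perm, Fintype.card_fun, Fintype.card_fin]
    rw [hbdef]; norm_num [Nat.factorial]
  have hb1 : (1 : ℝ) < b := by rw [hbdef]; norm_num
  have hb0 : (0 : ℝ) < b := by rw [hbdef]; norm_num
  -- the real pencil (Viro patchworking) and its positive zeros
  have hmain : 6 ≤ ((∑ l, (X : ℝ[X]) ^ D l • (patchMatrix b V E l).map C).det.roots.toFinset.filter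
      (fun t : ℝ => 0 < t)).card := by
    let τ : Fin 7 → ℝ := fun k => b ^ Th k
    have hτmono : StrictMono τ := fun i j hij => zpow_lt_zpow_right₀ hb1 (hθ hij)
    have hτpos : ∀ k, 0 < τ k := fun k => zpow_pos hb0 _
    refine Summit.ValiantsHypothesis.ValiantsHypothesis.Theorems.SymmetroidDescartes.le_card_posRoots_of_alternating
      _ 6 τ hτmono hτpos fun k => ?_
    rw [Summit.ValiantsHypothesis.ValiantsHypothesis.Theorems.SymmetroidDescartes.eval_det_pencil,
      Summit.ValiantsHypothesis.ValiantsHypothesis.Theorems.SymmetroidDescartes.eval_det_pencil]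
    exact det_patch_alternates b D V E hε Th (fun k => (Sg k, Cl k)) hdom halt hcard k
  -- the same pencil, read as a matrix of monomials `c i j · X ^ (e i j)`
  let c : Fin 6 → Fin 6 → ℝ := fun i j => patchMatrix b V E (L i j) i j
  let e : Fin 6 → Fin 6 → ℕ := fun i j => D (L i j)
  have hmat : (∑ l, (X : ℝ[X]) ^ D l • (patchMatrix b V E l).map C) =
      Matrix.of (fun i j => C (c i j) * (X : ℝ[X]) ^ e i j) := by
    ext i j
    rw [Matrix.sum_apply, Matrix.of_apply]
    rw [Finset.sum_eq_single (L i j)]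
    · rw [Matrix.smul_apply, Matrix.map_apply, smul_eq_mul, mul_comm]
    · intro l _ hl
      rw [Matrix.smul_apply, Matrix.map_apply, smul_eq_mul]
      simp only [patchMatrix, hL i j l hl, Int.cast_zero, zero_mul, map_zero, mul_zero]
    · intro h; exact absurd (Finset.mem_univ _) h
  refine ⟨c, e, ?_, ?_, ?_, ?_, ?_⟩
  · intro i j
    show patchMatrix b V E (L i j) i j = patchMatrix b V E (L j i) j i
    simp only [patchMatrix]
    rw [hLs i j, hVs i j, hEs i j]
  · intro i j
    show D (L i j) = D (L j i)
    rw [hLs i j]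
  · intro i j hij
    show patchMatrix b V E (L i j) i j = 0
    simp only [patchMatrix, hEc (L i j) i j hij, Int.cast_zero, zero_mul]
  · intro i
    show 0 < patchMatrix b V E (L i i) i i
    simp only [patchMatrix, (hLd i).1, (hLd i).2, Int.cast_one, one_mul, neg_zero, zpow_zero]
    norm_num
  · rw [← hmat]; exact hmain

/-- **The conjectured sharp constant `B m = m − 1` of the typed α target (lead R2102) is FALSE**: it is not the case that every real
symmetric tridiagonal matrix of monomials with positive diagonal coefficients has at most `m − 1` distinct positive determinant zeros
(failure at `m = 6`, by `exists_staticTridiagonal_definite_six`).  Only the constant is refuted; a linear law `B m ≤ C·m` is untouched.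
[corollary] -/
theorem not_staticTridiagonal_definite_posRoots_le_pred :
    ¬ (∀ (m : ℕ) (c : Fin m → Fin m → ℝ) (e : Fin m → Fin m → ℕ), (∀ i j, c i j = c j i) → (∀ i j, e i j = e j i) →
        (∀ i j : Fin m, (i : ℕ) + 1 < j ∨ (j : ℕ) + 1 < i → c i j = 0) → (∀ i, 0 < c i i) →
        ((Matrix.det (Matrix.of fun i j => C (c i j) * (X : ℝ[X]) ^ e i j)).roots.toFinset.filter
          (fun t : ℝ => 0 < t)).card ≤ m - 1) := by
  intro h
  obtain ⟨c, e, hc, he, hband, hpos, h6⟩ := exists_staticTridiagonal_definite_six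
  have := h 6 c e hc he hband hpos
  omega

end Summit.ValiantsHypothesis.ValiantsHypothesis.Theorems.KPlusLogSqLaw.TridiagonalSector
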